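import Summits.AtomisticToContinuum.Crystallization.Theorems.FreeSplittingCertificatesStrictSplittingRuleP1SiteLedger
import Summits.AtomisticToContinuum.Crystallization.Theorems.FreeSplittingCertificatesStrictSplittingRuleCoreJointSite

/-!
# `StrictSplittingRule` (stmt-AtomisticToContinuum-12560): THE TWO-SITE WRAPPER — H12⋆ `CoreJointCoercive a h κ₁ κ₃` from the site ledgers at the two sublattice representatives (P1 interpolant object, part 57)

Route `FreeSplittingCertificates`, crux r3 `StrictSplittingRule` (H12⋆ = `stub_coreJointCoercive`), unit b2b-freesplit-B gen 33.
VALUE = the composition (T9) of the kernel assembly map (HOME FAR-LEMMA-SPEC §23 (b)) ABOVE the site level: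
* `coreJointCoercive_of_siteIneq` — H12⋆ `CoreJointCoercive a h κ₁ κ₃` for the tables `(Y₁, β, p1BondOffsets, M₁ + M_far, N)` from: a finitely
  stencilled, `(1+r)⁻⁶`-decaying first-order design `β` with H1's identity at the two representatives `(0,0,0)`, `(1,0,0)`; near second-order
  tables `M₁, N` stencilled on `p1BondOffsets` and decaying; the diagonal FAR TABLE `M_far b e s s' = −[s = s']·κ(2/5)a⁻⁴·p1RecTable(p1SplitDensity R₁ R₂) b e s`
  (stencil: `p1RecTable_eq_zero_of_not_mem`; decay: `p1RecTable_fpChi_decay`; sums: `table_decay_add`); and the joint sitewise inequality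
  `CoreJointSiteIneq` at the two representatives for every finitely supported `u` — by `coreJointCoercive_of_two_sites`.
* `coreJointCoercive_of_ledgers` — the same with the sitewise inequality supplied by **`coreJointSiteIneq_of_ledgers`** (part 56) at each
  representative: H12⋆ on `(a,h)` from, per representative `p`, ANY far-share data (in-layer shares + allocation table, routed vertical shares +
  table, circumradius data), the PER-CELL BUDGET (B) in dyad form (`hB p`) and the NEAR-LEDGER INEQUALITY (`hNear p`, for every finitely supported `u`).
This is the ENDPOINT of the kernel assembly modulo the certificate-tier hypotheses, stated for general constants `κ₁, κ₃, κ, R₁ < R₂` and a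
general design `β` (the cell instantiates `κ₁ = 1/3`, `κ₃ = 1/12`, `κ = 193/125`, `(R₁,R₂) = (4.05, 5.4)a`, `β` = the landed line truss).
What is NOT in the kernel: (B) (◇ `hB`, CERT §31) and the near ledger + far tables/(S) + flux enclosure (◇ `hNear`, G9 of the map).
NOT a proof of H12⋆, NOT summit progress.  [folklore]
-/

noncomputable section

open Set Function Metric MeasureTheory Filter Topology
open scoped BigOperators NNReal ENNReal Classical

namespace Summit.AtomisticToContinuum.Crystallization.Theorems.StrictSplittingRuleBirth

open Literature.MathematicalPhysics.StatisticalMechanics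
open Summit.AtomisticToContinuum.Crystallization.Theorems.PalmUnimodularRigidity.LayeredLawsSelectHcp

/-! ## The far table is stencilled on `p1BondOffsets` -/

/-- A slot weight vanishes off the bond-offset stencil (slot tails and heads are cube corners). -/
theorem p1SlotW_eq_zero_of_not_mem {ι : Type*} [Fintype ι] (τ η : Bool → ι → ℤ × ℤ × ℤ) (hτ : ∀ b i, τ b i ∈ p1Corners)
    (hη : ∀ b i, η b i ∈ p1Corners) (c : ℤ × ℤ × ℤ → ℝ) (q : ℤ × ℤ × ℤ) {d : ℤ × ℤ × ℤ} (hd : d ∉ p1BondOffsets) :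
    p1SlotW τ η c q d = 0 := by
  unfold p1SlotW
  refine Finset.sum_eq_zero fun o _ => Finset.sum_eq_zero fun i _ => if_neg ?_
  rintro ⟨h1, h2⟩
  apply hd
  have hd' : d = η (p1Par (q - o)) i - τ (p1Par (q - o)) i := by rw [h1, h2, add_sub_cancel_left]
  rw [hd']
  exact sub_mem_p1BondOffsets (hτ _ _) (hη _ _)

/-- The matched bond weight vanishes off the bond-offset stencil. -/
theorem p1BondW_eq_zero_of_not_mem (W : (ℤ × ℤ × ℤ) × Fin 6 → ℝ) (q : ℤ × ℤ × ℤ) {d : ℤ × ℤ × ℤ} (hd : d ∉ p1BondOffsets) :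
    p1BondW W q d = 0 := by
  unfold p1BondW
  rw [p1SlotW_eq_zero_of_not_mem _ _ (fun b i => p1TetTail_mem b 0 i) (fun b i => p1TetHead_mem b 0 i) _ q hd,
    p1SlotW_eq_zero_of_not_mem _ _ (fun b i => p1TetTail_mem b 1 i) (fun b i => p1TetHead_mem b 1 i) _ q hd,
    p1SlotW_eq_zero_of_not_mem _ _ p1OctTail_mem p1OctHead_mem _ q hd, add_zero, add_zero]

/-- **The matched receipts table is stencilled on `p1BondOffsets`** (the `Y₂`-clause of `CoreJointCoercive` for the far table). -/
theorem p1RecTable_eq_zero_of_not_mem (a h : ℝ) (g : (Fin 3 → ℝ) → ℝ) (b : Bool) (e : ℤ × ℤ × ℤ) {d : ℤ × ℤ × ℤ}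
    (hd : d ∉ p1BondOffsets) : p1RecTable a h g b e d = 0 :=
  p1BondW_eq_zero_of_not_mem _ _ hd

/-! ## H12⋆ from the sitewise inequality at the two representatives -/

/-- **TWO-SITE WRAPPER (abstract site inequality).**  For a stencilled decaying first-order design `β` with H1's identity at the two sublattice
representatives, near tables `M₁, N` on `p1BondOffsets` with `(1+r)⁻⁶` decay, and `M = M₁ + M_far` with the diagonal far table of the split weight:
the joint sitewise inequality at the two representatives for every finitely supported `u` proves `CoreJointCoercive a h κ₁ κ₃`.
NOT a proof of H12⋆, NOT summit progress. -/
theorem coreJointCoercive_of_siteIneq {a h κ₁ κ₃ : ℝ} (ha : 0 < a) (hh : 0 < h)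
    (Y₁ : Finset (ℤ × ℤ × ℤ)) (β : Bool → (ℤ × ℤ × ℤ) → (ℤ × ℤ × ℤ) → ℝ)
    (hY₁ : ∀ b d s, s ∉ Y₁ → β b d s = 0)
    {Cβ : ℝ} (hβ : ∀ p q : ℤ × ℤ × ℤ, ∀ s, |β (decide (Even p.1)) (q - p) s| ≤ Cβ * ((1 + ‖hcpSite a h q - hcpSite a h p‖)⁻¹) ^ 6)
    (hH1 : ∀ u : ℤ × ℤ × ℤ → EuclideanSpace ℝ (Fin 3), (support u).Finite →
      ∀ p ∈ ({(0, 0, 0), (1, 0, 0)} : Finset (ℤ × ℤ × ℤ)),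
        (∑' q : ℤ × ℤ × ℤ, (if q = p then (0 : ℝ) else
            ljSqDeriv (‖hcpSite a h q - hcpSite a h p‖ ^ 2) *
              inner ℝ (hcpSite a h q - hcpSite a h p) (u q - u p))) +
          (∑' q : ℤ × ℤ × ℤ, (if q = p then (0 : ℝ) else
            ∑ s ∈ Y₁, (β (decide (Even p.1)) (q - p) s *
                inner ℝ (hcpSite a h (p + s) - hcpSite a h p) (u (p + s) - u p) -
              β (decide (Even q.1)) (p - q) s *
                inner ℝ (hcpSite a h (q + s) - hcpSite a h q) (u (q + s) - u q)))) = 0)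
    (M₁ N M : Bool → (ℤ × ℤ × ℤ) → (ℤ × ℤ × ℤ) → (ℤ × ℤ × ℤ) → ℝ)
    (hMN₁ : ∀ b d s s', s ∉ p1BondOffsets ∨ s' ∉ p1BondOffsets → M₁ b d s s' = 0 ∧ N b d s s' = 0)
    {C₁ : ℝ} (hdec₁ : ∀ p q : ℤ × ℤ × ℤ, ∀ s s', |M₁ (decide (Even p.1)) (q - p) s s'| ≤
        C₁ * ((1 + ‖hcpSite a h q - hcpSite a h p‖)⁻¹) ^ 6 ∧
      |N (decide (Even p.1)) (q - p) s s'| ≤ C₁ * ((1 + ‖hcpSite a h q - hcpSite a h p‖)⁻¹) ^ 6)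
    {R1 R2 : ℝ} (hR1 : 0 < R1) (hR12 : R1 < R2) {κ : ℝ} (hκ : 0 ≤ κ)
    (hM : ∀ b e s s', M b e s s' = M₁ b e s s' + (fun b e s s' => if s = s' then -(κ * (2 / 5) / a ^ 4 * p1RecTable a h (p1SplitDensity R1 R2) b e s) else 0) b e s s')
    (hsite : ∀ u : ℤ × ℤ × ℤ → EuclideanSpace ℝ (Fin 3), (support u).Finite →
      ∀ p ∈ ({(0, 0, 0), (1, 0, 0)} : Finset (ℤ × ℤ × ℤ)), CoreJointSiteIneq a h κ₁ κ₃ Y₁ β p1BondOffsets M N u p) :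
    CoreJointCoercive a h κ₁ κ₃ := by
  -- the far table as an opaque function
  obtain ⟨MF, hMF⟩ : ∃ MF : Bool → (ℤ × ℤ × ℤ) → (ℤ × ℤ × ℤ) → (ℤ × ℤ × ℤ) → ℝ, ∀ b e s s',
      MF b e s s' = if s = s' then -(κ * (2 / 5) / a ^ 4 * p1RecTable a h (p1SplitDensity R1 R2) b e s) else 0 :=
    ⟨_, fun _ _ _ _ => rfl⟩
  have hM' : ∀ b e s s', M b e s s' = M₁ b e s s' + MF b e s s' := fun b e s s' => by rw [hM, hMF]
  -- decay of the far table in H12⋆'s convention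
  obtain ⟨CR, hCR⟩ := p1RecTable_fpChi_decay ha hh hR1 hR12
  have hRdec : ∀ p q : ℤ × ℤ × ℤ, ∀ s, |p1RecTable a h (p1SplitDensity R1 R2) (decide (Even p.1)) (q - p) s| ≤
      CR * ((1 + ‖hcpSite a h q - hcpSite a h p‖)⁻¹) ^ 6 := by
    intro p q s
    have h1 := (hCR q p s).2
    rw [norm_sub_rev] at h1
    exact h1
  have hCR0 : 0 ≤ CR := by
    have h1 := hRdec 0 0 0
    simp only [sub_self, norm_zero, add_zero, inv_one, one_pow, mul_one] at h1
    exact (abs_nonneg _).trans h1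
  set CF : ℝ := κ * (2 / 5) / a ^ 4 * CR with hCF
  have hCF0 : 0 ≤ CF := by positivity
  have hFdec : ∀ p q : ℤ × ℤ × ℤ, ∀ s s',
      |MF (decide (Even p.1)) (q - p) s s'| ≤ CF * ((1 + ‖hcpSite a h q - hcpSite a h p‖)⁻¹) ^ 6 := by
    intro p q s s'
    rw [hMF]
    split_ifs
    · rw [abs_neg, abs_mul, abs_of_nonneg (by positivity : (0 : ℝ) ≤ κ * (2 / 5) / a ^ 4), hCF, mul_assoc]
      exact mul_le_mul_of_nonneg_left (hRdec p q s) (by positivity)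
    · rw [abs_zero]; positivity
  have hMdec := table_decay_add (a := a) (h := h) M₁ MF (fun p q s s' => (hdec₁ p q s s').1) hFdec
  -- constants: nonnegativity and one common constant
  have hw0 : ∀ p q : ℤ × ℤ × ℤ, (0 : ℝ) ≤ ((1 + ‖hcpSite a h q - hcpSite a h p‖)⁻¹) ^ 6 := fun p q => by positivity
  set C : ℝ := max Cβ (C₁ + CF) with hC
  refine coreJointCoercive_of_two_sites ⟨C, Y₁, β, p1BondOffsets, M, N, hY₁, ?_, ?_, ?_, fun u hu p hp => ⟨hH1 u hu p hp, hsite u hu p hp⟩⟩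
  · intro p q s
    exact (hβ p q s).trans (mul_le_mul_of_nonneg_right (le_max_left _ _) (hw0 p q))
  · intro b d s s' hss
    refine ⟨?_, (hMN₁ b d s s' hss).2⟩
    rw [hM', (hMN₁ b d s s' hss).1, zero_add, hMF]
    split_ifs with hs
    · subst hs
      have hs' : s ∉ p1BondOffsets := by rcases hss with h1 | h1 <;> exact h1
      rw [p1RecTable_eq_zero_of_not_mem a h _ b d hs', mul_zero, neg_zero]
    · rfl
  · intro p q s s'
    refine ⟨?_, ((hdec₁ p q s s').2).trans (mul_le_mul_of_nonneg_right
      ((le_add_of_nonneg_right hCF0).trans (le_max_right _ _)) (hw0 p q))⟩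
    rw [hM']
    exact (hMdec p q s s').trans (mul_le_mul_of_nonneg_right (le_max_right _ _) (hw0 p q))

/-! ## H12⋆ from the two site ledgers -/

/-- **TWO-SITE WRAPPER (site ledgers) — the endpoint of the kernel assembly modulo the certificate-tier hypotheses.**  `CoreJointCoercive a h κ₁ κ₃` on
the `HcpFamilyMin` box from: a stencilled decaying design `β` with H1's identity at the two representatives; near tables `M₁, N` on `p1BondOffsets`, decaying;
`M = M₁ + M_far`; and, for each representative `p ∈ {(0,0,0), (1,0,0)}`, any far-share / routing / circumradius data together with the PER-CELL BUDGET (B)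
in dyad form (`hB`) and the NEAR-LEDGER INEQUALITY for every finitely supported `u` (`hNear`) — composed by `coreJointSiteIneq_of_ledgers` and
`coreJointCoercive_of_siteIneq`.  NOT a proof of H12⋆ (the two ◇ hypotheses per representative remain, by design), NOT summit progress. -/
theorem coreJointCoercive_of_ledgers {a h κ₁ κ₃ : ℝ} (ha : 0 < a) (hh : 0 < h) (hfam : HcpFamilyMin a h)
    (Y₁ : Finset (ℤ × ℤ × ℤ)) (β : Bool → (ℤ × ℤ × ℤ) → (ℤ × ℤ × ℤ) → ℝ)
    (hY₁ : ∀ b d s, s ∉ Y₁ → β b d s = 0)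
    {Cβ : ℝ} (hβ : ∀ p q : ℤ × ℤ × ℤ, ∀ s, |β (decide (Even p.1)) (q - p) s| ≤ Cβ * ((1 + ‖hcpSite a h q - hcpSite a h p‖)⁻¹) ^ 6)
    (hH1 : ∀ u : ℤ × ℤ × ℤ → EuclideanSpace ℝ (Fin 3), (support u).Finite →
      ∀ p ∈ ({(0, 0, 0), (1, 0, 0)} : Finset (ℤ × ℤ × ℤ)),
        (∑' q : ℤ × ℤ × ℤ, (if q = p then (0 : ℝ) else
            ljSqDeriv (‖hcpSite a h q - hcpSite a h p‖ ^ 2) *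
              inner ℝ (hcpSite a h q - hcpSite a h p) (u q - u p))) +
          (∑' q : ℤ × ℤ × ℤ, (if q = p then (0 : ℝ) else
            ∑ s ∈ Y₁, (β (decide (Even p.1)) (q - p) s *
                inner ℝ (hcpSite a h (p + s) - hcpSite a h p) (u (p + s) - u p) -
              β (decide (Even q.1)) (p - q) s *
                inner ℝ (hcpSite a h (q + s) - hcpSite a h q) (u (q + s) - u q)))) = 0)
    (M₁ N M : Bool → (ℤ × ℤ × ℤ) → (ℤ × ℤ × ℤ) → (ℤ × ℤ × ℤ) → ℝ)
    (hMN₁ : ∀ b d s s', s ∉ p1BondOffsets ∨ s' ∉ p1BondOffsets → M₁ b d s s' = 0 ∧ N b d s s' = 0)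
    {C₁ : ℝ} (hdec₁ : ∀ p q : ℤ × ℤ × ℤ, ∀ s s', |M₁ (decide (Even p.1)) (q - p) s s'| ≤
        C₁ * ((1 + ‖hcpSite a h q - hcpSite a h p‖)⁻¹) ^ 6 ∧
      |N (decide (Even p.1)) (q - p) s s'| ≤ C₁ * ((1 + ‖hcpSite a h q - hcpSite a h p‖)⁻¹) ^ 6)
    {R1 R2 : ℝ} (hR1 : 0 < R1) (hR12 : R1 < R2) {κ : ℝ} (hκ : 0 ≤ κ)
    (hM : ∀ b e s s', M b e s s' = M₁ b e s s' + (fun b e s s' => if s = s' then -(κ * (2 / 5) / a ^ 4 * p1RecTable a h (p1SplitDensity R1 R2) b e s) else 0) b e s s')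
    -- per representative: in-layer far shares and their allocation table
    (w : (ℤ × ℤ × ℤ) → (ℤ × ℤ × ℤ) × (ℤ × ℤ × ℤ) → ℝ) (hw : ∀ p e, 0 ≤ w p e)
    (hws : ∀ p ∈ ({(0, 0, 0), (1, 0, 0)} : Finset (ℤ × ℤ × ℤ)),
      Summable fun e : (ℤ × ℤ × ℤ) × (ℤ × ℤ × ℤ) => w p e * fpSq (fun k => hcpSite a h (e.1 + e.2) k - hcpSite a h e.1 k))
    (θ : (ℤ × ℤ × ℤ) → (ℤ × ℤ × ℤ) × (ℤ × ℤ × ℤ) → (ℤ × ℤ × ℤ) × Fin 6 → ℝ) (hθ : ∀ p e T, 0 ≤ θ p e T)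
    (hfinE : ∀ p e, (Function.support (θ p e)).Finite) (hfinC : ∀ p T, (Function.support fun e => θ p e T).Finite)
    (hsum : ∀ p e, w p e ≠ 0 → ∑ᶠ T, θ p e T = 1)
    (hcar : ∀ p e T, θ p e T ≠ 0 → ∃ m m' : Fin 4, e.1 = T.1 + p1VertOff (p1Par T.1) T.2 m ∧
      e.1 + e.2 = T.1 + p1VertOff (p1Par T.1) T.2 m')
    -- per representative: vertical far shares, routing offsets and their allocation table
    (sv : (ℤ × ℤ × ℤ) → ℤ × ℤ × ℤ) (o : (ℤ × ℤ × ℤ) → (ℤ × ℤ × ℤ) → Fin 3 → ℤ × ℤ × ℤ) (S : Finset (ℤ × ℤ × ℤ))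
    (ho : ∀ p q i, o p q i ∈ S)
    (wv : (ℤ × ℤ × ℤ) → (ℤ × ℤ × ℤ) → ℝ) (hwv : ∀ p q, 0 ≤ wv p q) (hwvs : ∀ p, Summable (wv p))
    (θv : (ℤ × ℤ × ℤ) → (ℤ × ℤ × ℤ) × (ℤ × ℤ × ℤ) → (ℤ × ℤ × ℤ) × Fin 6 → ℝ) (hθv : ∀ p e T, 0 ≤ θv p e T)
    (hfinEv : ∀ p e, (Function.support (θv p e)).Finite) (hfinCv : ∀ p T, (Function.support fun e => θv p e T).Finite)
    (hsumv : ∀ p e, (∑ i : Fin 3, (2 / 3) * ((if e.2 = o p e.1 i then wv p e.1 else 0) +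
        (if o p (e.1 - (sv p - e.2)) i = sv p - e.2 then wv p (e.1 - (sv p - e.2)) else 0))) ≠ 0 → ∑ᶠ T, θv p e T = 1)
    (hcarv : ∀ p e T, θv p e T ≠ 0 → ∃ m m' : Fin 4, e.1 = T.1 + p1VertOff (p1Par T.1) T.2 m ∧
      e.1 + e.2 = T.1 + p1VertOff (p1Par T.1) T.2 m')
    -- per representative: circumradius data of the cells
    (cT : (ℤ × ℤ × ℤ) → (ℤ × ℤ × ℤ) × Fin 6 → Fin 3 → ℝ) (ρ : (ℤ × ℤ × ℤ) → (ℤ × ℤ × ℤ) × Fin 6 → ℝ)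
    (hρ : ∀ p i, ∀ m : Fin 4, fpSq (fun k => hcpSite a h (i.1 + p1VertOff (p1Par i.1) i.2 m) k - cT p i k) ≤ ρ p i)
    (ρ₀ : (ℤ × ℤ × ℤ) → ℝ) (hρ₀ : ∀ p i, |ρ p i| ≤ ρ₀ p)
    -- THE PER-CELL BUDGET (B) at each representative, dyad form, weights re-centred at `y_p`
    (hB : ∀ p ∈ ({(0, 0, 0), (1, 0, 0)} : Finset (ℤ × ℤ × ℤ)), ∀ (T : (ℤ × ℤ × ℤ) × Fin 6) (G : Fin 3 → Fin 3 → ℝ),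
      (∑ᶠ e : (ℤ × ℤ × ℤ) × (ℤ × ℤ × ℤ), θ p e T * w p e *
          fpSq (fun k => (hcpSite a h (e.1 + e.2) 0 - hcpSite a h e.1 0) * G 0 k +
            (hcpSite a h (e.1 + e.2) 1 - hcpSite a h e.1 1) * G 1 k + (hcpSite a h (e.1 + e.2) 2 - hcpSite a h e.1 2) * G 2 k)) +
      (∑ᶠ e : (ℤ × ℤ × ℤ) × (ℤ × ℤ × ℤ), θv p e T *
          (∑ i : Fin 3, (2 / 3) * ((if e.2 = o p e.1 i then wv p e.1 else 0) +
            (if o p (e.1 - (sv p - e.2)) i = sv p - e.2 then wv p (e.1 - (sv p - e.2)) else 0))) *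
          fpSq (fun k => (hcpSite a h (e.1 + e.2) 0 - hcpSite a h e.1 0) * G 0 k +
            (hcpSite a h (e.1 + e.2) 1 - hcpSite a h e.1 1) * G 1 k + (hcpSite a h (e.1 + e.2) 2 - hcpSite a h e.1 2) * G 2 k)) +
      (∫ y in p1RealCell a h T, κ * ((7 * (5 / 4 : ℝ) + 3 / 4) / 4) * fpChi (R1 ^ 2) (R2 ^ 2) (y - fun k => hcpSite a h p k) ^ 2 *
          (fpSq (y - fun k => hcpSite a h p k))⁻¹ ^ 4) * (ρ p T * fpFrob G) ≤
      κ * ((5 / 2 * (1 / 24 * fpSymSq G) + 5 / 2 * (1 / 24 * (fpFrob G - fpSymSq G))) *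
        ∫ y in p1RealCell a h T, fpChi (R1 ^ 2) (R2 ^ 2) (y - fun k => hcpSite a h p k) ^ 2 * (fpSq (y - fun k => hcpSite a h p k))⁻¹ ^ 3))
    -- THE NEAR-LEDGER INEQUALITY at each representative, for every finitely supported `u` (certificate tier + identification, G9)
    (hNear : ∀ p ∈ ({(0, 0, 0), (1, 0, 0)} : Finset (ℤ × ℤ × ℤ)), ∀ u : ℤ × ℤ × ℤ → EuclideanSpace ℝ (Fin 3), (support u).Finite →
      ∀ (W : EuclideanSpace ℝ (Fin 3) →ₗ[ℝ] EuclideanSpace ℝ (Fin 3)),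
      (∀ z : EuclideanSpace ℝ (Fin 3), inner ℝ (W z) z = 0) →
      (∀ W' : EuclideanSpace ℝ (Fin 3) →ₗ[ℝ] EuclideanSpace ℝ (Fin 3), (∀ z : EuclideanSpace ℝ (Fin 3), inner ℝ (W' z) z = 0) →
        (∑' q : ℤ × ℤ × ℤ,
            (if 0 < ‖hcpSite a h q - hcpSite a h p‖ ∧ ‖hcpSite a h q - hcpSite a h p‖ ≤ 11 / 10 * a then
              ‖u q - u p - W (hcpSite a h q - hcpSite a h p)‖ ^ 2 else (0 : ℝ))) ≤
        (∑' q : ℤ × ℤ × ℤ,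
            (if 0 < ‖hcpSite a h q - hcpSite a h p‖ ∧ ‖hcpSite a h q - hcpSite a h p‖ ≤ 11 / 10 * a then
              ‖u q - u p - W' (hcpSite a h q - hcpSite a h p)‖ ^ 2 else (0 : ℝ)))) →
      ∀ (A : Fin 3 → Fin 3 → ℝ), (∀ (y : EuclideanSpace ℝ (Fin 3)) (k : Fin 3), W y k = y 0 * A 0 k + y 1 * A 1 k + y 2 * A 2 k) →
      κ₁ * (∑' q : ℤ × ℤ × ℤ,
        (if 0 < ‖hcpSite a h q - hcpSite a h p‖ ∧ ‖hcpSite a h q - hcpSite a h p‖ ≤ 11 / 10 * a then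
          (inner ℝ (hcpSite a h q - hcpSite a h p) (u q - u p)) ^ 2 else (0 : ℝ))) +
      κ₃ * (∑' q : ℤ × ℤ × ℤ,
        (if 0 < ‖hcpSite a h q - hcpSite a h p‖ ∧ ‖hcpSite a h q - hcpSite a h p‖ ≤ 11 / 10 * a then
          ‖u q - u p - W (hcpSite a h q - hcpSite a h p)‖ ^ 2 else (0 : ℝ))) +
      (∑' q : ℤ × ℤ × ℤ, (if q = p then (0 : ℝ) else
        ∑ s ∈ Y₁,
          (β (decide (Even q.1)) (p - q) s *
              (1 / 2 * ‖u (q + s) - u q - W (hcpSite a h (q + s) - hcpSite a h q)‖ ^ 2) -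
            β (decide (Even p.1)) (q - p) s *
              (1 / 2 * ‖u (p + s) - u p - W (hcpSite a h (p + s) - hcpSite a h p)‖ ^ 2)))) -
      ((∑' e : (ℤ × ℤ × ℤ) × (ℤ × ℤ × ℤ), w p e * ‖u (e.1 + e.2) - u e.1 - W (hcpSite a h (e.1 + e.2) - hcpSite a h e.1)‖ ^ 2) +
    (∑' q : ℤ × ℤ × ℤ, wv p q * ‖u (q + sv p) - u q - W (hcpSite a h (q + sv p) - hcpSite a h q)‖ ^ 2) +
    (∑' q, p1SiteBare a h (fun y k l => κ * ((7 * (5 / 4 : ℝ) + 3 / 4) / 4) * fpChi (R1 ^ 2) (R2 ^ 2) (y - fun k => hcpSite a h p k) ^ 2 *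
        (fpSq (y - fun k => hcpSite a h p k))⁻¹ ^ 5 * ((y - fun k => hcpSite a h p k) k * (y - fun k => hcpSite a h p k) l))
        (fun n k => p1DispSite a h (fun n k => u n k) (fun k => u p k - (hcpSite a h p 0 * A 0 k + hcpSite a h p 1 * A 1 k + hcpSite a h p 2 * A 2 k)) A n k) q) -
    (∑' q, p1SiteBare a h (fun y k l => κ * ((3 / 4 : ℝ) / 4) * fpChi (R1 ^ 2) (R2 ^ 2) (y - fun k => hcpSite a h p k) ^ 2 *
        (fpSq (y - fun k => hcpSite a h p k))⁻¹ ^ 4 * (if k = l then 1 else 0))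
        (fun n k => p1DispSite a h (fun n k => u n k) (fun k => u p k - (hcpSite a h p 0 * A 0 k + hcpSite a h p 1 * A 1 k + hcpSite a h p 2 * A 2 k)) A n k) q)) -
      (∑' q : ℤ × ℤ × ℤ, (if q = p then (0 : ℝ) else
        1 / 2 * (ljSqDeriv (‖hcpSite a h q - hcpSite a h p‖ ^ 2) *
            ‖u q - u p - W (hcpSite a h q - hcpSite a h p)‖ ^ 2 +
          2 * (1 / 2 * (7 * ((‖hcpSite a h q - hcpSite a h p‖ ^ 2)⁻¹) ^ 8 -
            4 * ((‖hcpSite a h q - hcpSite a h p‖ ^ 2)⁻¹) ^ 5)) *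
            (inner ℝ (hcpSite a h q - hcpSite a h p) (u q - u p)) ^ 2))) -
      (∑' q : ℤ × ℤ × ℤ, (if q = p then (0 : ℝ) else
        ∑ s ∈ p1BondOffsets, ∑ s' ∈ p1BondOffsets,
          (M₁ (decide (Even p.1)) (q - p) s s' *
              (inner ℝ (hcpSite a h (p + s) - hcpSite a h p) (u (p + s) - u p) *
                inner ℝ (hcpSite a h (p + s') - hcpSite a h p) (u (p + s') - u p)) -
            M₁ (decide (Even q.1)) (p - q) s s' *
              (inner ℝ (hcpSite a h (q + s) - hcpSite a h q) (u (q + s) - u q) *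
                inner ℝ (hcpSite a h (q + s') - hcpSite a h q) (u (q + s') - u q)) +
            (N (decide (Even p.1)) (q - p) s s' - N (decide (Even q.1)) (p - q) s' s) *
              (inner ℝ (hcpSite a h (p + s) - hcpSite a h p) (u (p + s) - u p) *
                inner ℝ (hcpSite a h (q + s') - hcpSite a h q) (u (q + s') - u q))))) +
      κ * (2 / 5) / a ^ 4 * (∑' q : ℤ × ℤ × ℤ, if q = p then (0 : ℝ) else
        ∑ s ∈ p1BondOffsets, p1RecTable a h (p1SplitDensity R1 R2) (decide (Even p.1)) (q - p) s *
          (inner ℝ (hcpSite a h (p + s) - hcpSite a h p) (u (p + s) - u p)) ^ 2) +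
      κ * (2 / 5) / a ^ 4 * (∑ d ∈ p1BondOffsets, p1RecTable a h (p1SplitDensity R1 R2) (p1Par p) (p - p) d *
          (inner ℝ (hcpSite a h (p + d) - hcpSite a h p) (u (p + d) - u p)) ^ 2) +
      κ * (∑' i, p1FluxQuad₀ (R1 ^ 2) (R2 ^ 2) (1 / 3) (4 / 3) (-9 / 8) (1 / 8) a h (fun k => hcpSite a h p k) i
        (p1CellVals (fun n k => p1DispSite a h (fun n k => u n k) (fun k => u p k - (hcpSite a h p 0 * A 0 k + hcpSite a h p 1 * A 1 k + hcpSite a h p 2 * A 2 k)) A n k) i)) ≤ 0) :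
    CoreJointCoercive a h κ₁ κ₃ := by
  refine coreJointCoercive_of_siteIneq ha hh Y₁ β hY₁ hβ hH1 M₁ N M hMN₁ hdec₁ hR1 hR12 hκ hM fun u hu p hp => ?_
  have hTR₁ := stub_summableTransfer a h C₁ ha hh p1BondOffsets M₁ N hdec₁ u hu p
  exact coreJointSiteIneq_of_ledgers ha hh hfam Y₁ β M₁ M N hR1 hR12 hκ hM u hu p hTR₁
    (w p) (hw p) (hws p hp) (θ p) (hθ p) (hfinE p) (hfinC p) (hsum p) (hcar p)
    (sv p) (o p) S (ho p) (wv p) (hwv p) (hwvs p) (θv p) (hθv p) (hfinEv p) (hfinCv p) (hsumv p) (hcarv p)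
    (cT p) (ρ p) (hρ p) (hρ₀ p) (hB p hp) (hNear p hp u hu)

end Summit.AtomisticToContinuum.Crystallization.Theorems.StrictSplittingRuleBirth

end
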